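import Mathlib

/-!
# The smooth solution of the scalar Euler equation `x Y′ = ν Y + G` with a `C^k → C⁰` estimate
# (crux `DenseExcursion`, line `sonic-cavity-renewal`, brick for stub `stub_cavityResolventCk`, theorem T2)

Helper file (`--supports stmt-AtomisticToContinuum-12586`, line lead a2, stub-worker W4 for `stub_cavityResolventCk`).
The model problem behind the smooth branch at the repulsive sonic point: for `ν ∈ ℂ` with `Re ν ≤ k − 1`, `Im ν ≠ 0`
(no jet resonance) and `G` of class `C^∞` on `(−ρ, ρ)`, `ρ ≤ 1`, the Euler equation `x Y′ = ν Y + G` has a `C^∞`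
solution on `(−ρ, ρ)` with the LOSS-OF-`k`-DERIVATIVES estimate `‖Y(x)‖ ≤ (k/|Im ν| + 1)·sup_{|y|≤|x|, j≤k} ‖G⁽ʲ⁾(y)‖`
(registered helper `euler_smooth_solution`): subtract the Taylor polynomial of order `k − 1` of `G` (solved by
`Σ_{n<k} G⁽ⁿ⁾(0)xⁿ/(n!(n − ν))`, `|n − ν| ≥ |Im ν|`) and solve the flat remainder `G̃ = O(|x|^k)` by
`I(x) = ∫₀¹ s^{−ν−1} G̃(xs) ds`, whose integrand is BOUNDED as `k − Re ν ≥ 1`; smoothness by differentiation under the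
integral (`I⁽ʲ⁾(x) = ∫₀¹ s^{j−ν−1} G̃⁽ʲ⁾(xs) ds`), the equation by one integration by parts in `s`. Generic bricks: a
chain of derivatives on an open set is smooth (`contDiffOn_of_deriv_family`); flat chains are `O(|x|ⁿ)`
(`norm_le_of_flat_family_gen`). Sources: Coddington–Levinson 1955 Ch. 4 §2; Chen–Shkoller–Vicol arXiv:2605.00808 §1.10.
-/

noncomputable section

open Set Filter MeasureTheory intervalIntegral
open scoped Topology ContDiff Nat Interval

namespace Summit.AtomisticToContinuum.HydrodynamicLimit.Theorems.SonicCavityRenewal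

section Generic

variable {E : Type*} [NormedAddCommGroup E] [NormedSpace ℝ E]

/-- A family of functions on an open set, each the derivative of the previous one, consists of `C^∞` functions.
[folklore] -/
theorem contDiffOn_of_deriv_family {s : Set ℝ} (hs : IsOpen s) (F : ℕ → ℝ → E)
    (hF : ∀ j, ∀ x ∈ s, HasDerivAt (F j) (F (j + 1) x) x) (j : ℕ) : ContDiffOn ℝ ∞ (F j) s := by
  suffices h : ∀ n : ℕ, ∀ j, ContDiffOn ℝ n (F j) s from contDiffOn_infty.2 fun n => h n j
  intro n
  induction n with
  | zero => exact fun j => contDiffOn_zero.2 fun x hx => (hF j x hx).continuousAt.continuousWithinAt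
  | succ n ih =>
    intro j
    rw [Nat.cast_succ]
    exact (contDiffOn_succ_iff_deriv_of_isOpen hs).2 ⟨fun x hx => (hF j x hx).differentiableAt.differentiableWithinAt,
      fun h => absurd h WithTop.coe_ne_top, (ih (j + 1)).congr fun x hx => (hF j x hx).deriv⟩

/-- FLAT CHAINS ARE SMALL: if `F₀, …, Fₙ` is a chain of derivatives on `[−r, r]` with `Fⱼ(0) = 0` for `j < n` and
`‖Fₙ‖ ≤ M`, then `‖F₀(y)‖ ≤ M |y|ⁿ` (mean value inequality, induction). [folklore] -/
theorem norm_le_of_flat_family_gen (n : ℕ) : ∀ (F : ℕ → ℝ → E) (r M : ℝ),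
    (∀ j < n, ∀ y ∈ Icc (-r) r, HasDerivAt (F j) (F (j + 1) y) y) → (∀ j < n, F j 0 = 0) →
    (∀ y ∈ Icc (-r) r, ‖F n y‖ ≤ M) → ∀ y ∈ Icc (-r) r, ‖F 0 y‖ ≤ M * |y| ^ n := by
  induction n with
  | zero => intro F r M _ _ hM y hy; simpa using hM y hy
  | succ n ih =>
    intro F r M hd h0 hM y hy
    have hM0 : 0 ≤ M := (norm_nonneg _).trans (hM y hy)
    have ih' : ∀ z ∈ Icc (-r) r, ‖F 1 z‖ ≤ M * |z| ^ n := ih (fun j => F (j + 1)) r M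
      (fun j hj z hz => hd (j + 1) (by omega) z hz) (fun j hj => h0 (j + 1) (by omega)) hM
    have hsub : uIcc 0 y ⊆ Icc (-r) r := uIcc_subset_Icc ⟨by linarith [hy.1, hy.2], by linarith [hy.1, hy.2]⟩ hy
    have hb : ∀ z ∈ uIcc 0 y, ‖F 1 z‖ ≤ M * |y| ^ n := by
      intro z hz
      have hzy : |z| ≤ |y| := by
        rcases mem_uIcc.1 hz with h | h
        · rw [abs_of_nonneg h.1, abs_of_nonneg (h.1.trans h.2)]; exact h.2
        · rw [abs_of_nonpos h.2, abs_of_nonpos (h.1.trans h.2)]; linarith [h.1]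
      exact (ih' z (hsub hz)).trans (mul_le_mul_of_nonneg_left (pow_le_pow_left₀ (abs_nonneg z) hzy n) hM0)
    have key := Convex.norm_image_sub_le_of_norm_hasDerivWithin_le
      (fun z hz => (hd 0 (by omega) z (hsub hz)).hasDerivWithinAt) hb (convex_uIcc 0 y) left_mem_uIcc right_mem_uIcc
    rw [h0 0 (by omega), sub_zero, sub_zero, Real.norm_eq_abs] at key
    calc ‖F 0 y‖ ≤ M * |y| ^ n * |y| := key
      _ = M * |y| ^ (n + 1) := by ring

/-- On an open set, the iterated derivatives of a `C^∞` function form a chain of derivatives. [folklore] -/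
theorem hasDerivAt_iteratedDeriv_of_contDiffOn {s : Set ℝ} (hs : IsOpen s) {G : ℝ → E}
    (hG : ContDiffOn ℝ ∞ G s) (j : ℕ) {y : ℝ} (hy : y ∈ s) :
    HasDerivAt (iteratedDeriv j G) (iteratedDeriv (j + 1) G y) y := by
  have h : ContDiffOn ℝ ∞ (iteratedDeriv j G) s := by
    induction j with
    | zero => simpa using hG
    | succ j ih => rw [iteratedDeriv_succ]; exact ih.deriv_of_isOpen hs (le_of_eq rfl)
  rw [iteratedDeriv_succ]
  exact (((h.differentiableOn (by simp)) y hy).differentiableAt (hs.mem_nhds hy)).hasDerivAt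

end Generic

/-! ### Taylor sums -/

/-- Derivative of the Taylor sum `Σ_{n<m} cₙ yⁿ/n!` (real variable, complex coefficients): the shifted Taylor sum.
[folklore] -/
theorem hasDerivAt_taylorSum (c : ℕ → ℂ) (m : ℕ) (y : ℝ) :
    HasDerivAt (fun y : ℝ => ∑ n ∈ Finset.range m, c n / (n ! : ℂ) * (y : ℂ) ^ n)
      (∑ n ∈ Finset.range (m - 1), c (n + 1) / (n ! : ℂ) * (y : ℂ) ^ n) y := by
  have h : HasDerivAt (fun y : ℝ => ∑ n ∈ Finset.range m, c n / (n ! : ℂ) * (y : ℂ) ^ n)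
      (∑ n ∈ Finset.range m, c n / (n ! : ℂ) * ((n : ℂ) * (y : ℂ) ^ (n - 1))) y :=
    HasDerivAt.fun_sum fun n _ => ((hasDerivAt_pow n (y : ℂ)).comp_ofReal).const_mul _
  convert h using 1
  cases m with
  | zero => simp
  | succ m =>
    rw [Finset.sum_range_succ', Nat.add_sub_cancel]
    simp only [Nat.cast_zero, zero_mul, mul_zero, add_zero, Nat.add_sub_cancel]
    refine Finset.sum_congr rfl fun n _ => ?_
    have h1 : ((n + 1)! : ℂ) = (n + 1 : ℂ) * (n ! : ℂ) := by rw [Nat.factorial_succ]; push_cast; ring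
    have h2 : (n ! : ℂ) ≠ 0 := by exact_mod_cast Nat.factorial_ne_zero n
    have h3 : (n + 1 : ℂ) ≠ 0 := Nat.cast_add_one_ne_zero n
    rw [h1]
    field_simp
    push_cast
    ring

/-- The chain of derivatives of a Taylor sum: `y ↦ Σ_{n<m−l} c_{n+l} yⁿ/n!` differentiates to the next one. [folklore] -/
theorem hasDerivAt_taylorSum_family (c : ℕ → ℂ) (m l : ℕ) (y : ℝ) :
    HasDerivAt (fun y : ℝ => ∑ n ∈ Finset.range (m - l), c (n + l) / (n ! : ℂ) * (y : ℂ) ^ n)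
      (∑ n ∈ Finset.range (m - (l + 1)), c (n + (l + 1)) / (n ! : ℂ) * (y : ℂ) ^ n) y := by
  have h := hasDerivAt_taylorSum (fun n => c (n + l)) (m - l) y
  have e : m - l - 1 = m - (l + 1) := by omega
  simp only [e] at h
  convert h using 3
  simp only [add_assoc, add_comm 1 l]

/-- The value at `0` of the `l`-th member of the Taylor-sum chain is `c_l` (if `l < m`) or `0`. [folklore] -/
theorem taylorSum_family_zero (c : ℕ → ℂ) (m l : ℕ) :
    (∑ n ∈ Finset.range (m - l), c (n + l) / (n ! : ℂ) * ((0 : ℝ) : ℂ) ^ n) = if l < m then c l else 0 := by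
  split_ifs with h
  · rw [Finset.sum_eq_single 0 (fun n _ hn => by simp [zero_pow hn])
      (fun h0 => absurd (Finset.mem_range.2 (by omega)) h0)]
    simp
  · simp [Nat.sub_eq_zero_of_le (not_lt.1 h)]

/-! ### The Euler equation -/

/-- Integrand bound: if `‖D y‖ ≤ B|y|^q` on `[−r, r]`, then for `|x| ≤ r`, `0 < s ≤ 1` and `Re a + q ≥ 0`,
`‖s^a D(xs)‖ ≤ B r^q` (`‖s^a‖ = s^{Re a}` and `s^{Re a + q} ≤ 1`). [folklore] -/
theorem norm_cpow_mul_le {D : ℝ → ℂ} {B r : ℝ} {q : ℕ} {a : ℂ} (hB : 0 ≤ B) (hr : 0 ≤ r)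
    (hD : ∀ y ∈ Icc (-r) r, ‖D y‖ ≤ B * |y| ^ q) (ha : 0 ≤ a.re + q) {x : ℝ} (hx : |x| ≤ r) {s : ℝ}
    (hs : s ∈ Ioc (0 : ℝ) 1) : ‖(s : ℂ) ^ a * D (x * s)‖ ≤ B * r ^ q := by
  have hs0 : 0 < s := hs.1
  have habs : |x * s| ≤ r := by
    rw [abs_mul, abs_of_pos hs0]; exact (mul_le_of_le_one_right (abs_nonneg x) hs.2).trans hx
  have hxs : x * s ∈ Icc (-r) r := ⟨by linarith [(abs_le.1 habs).1], (abs_le.1 habs).2⟩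
  rw [norm_mul, Complex.norm_cpow_eq_rpow_re_of_pos hs0]
  calc s ^ a.re * ‖D (x * s)‖ ≤ s ^ a.re * (B * |x * s| ^ q) :=
        mul_le_mul_of_nonneg_left (hD _ hxs) (Real.rpow_nonneg hs0.le _)
    _ = B * |x| ^ q * (s ^ a.re * s ^ (q : ℝ)) := by rw [abs_mul, abs_of_pos hs0, mul_pow, Real.rpow_natCast]; ring
    _ = B * |x| ^ q * s ^ (a.re + q) := by rw [Real.rpow_add hs0]
    _ ≤ B * r ^ q * 1 := by
        apply mul_le_mul (mul_le_mul_of_nonneg_left (pow_le_pow_left₀ (abs_nonneg x) hx q) hB)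
          (Real.rpow_le_one hs0.le hs.2 ha) (Real.rpow_nonneg hs0.le _) (by positivity)
    _ = B * r ^ q := mul_one _

/-- `s^a · s = s^{a+1}` for a positive real base. [folklore] -/
theorem ofReal_cpow_mul_self {s : ℝ} (hs : 0 < s) (a : ℂ) : (s : ℂ) ^ a * (s : ℂ) = (s : ℂ) ^ (a + 1) := by
  rw [Complex.cpow_add _ _ (Complex.ofReal_ne_zero.2 hs.ne'), Complex.cpow_one]

/-- **Registered helper `euler_smooth_solution`: THE SMOOTH SOLUTION OF THE SCALAR EULER EQUATION WITH A `C^k → C⁰`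
ESTIMATE.** For `Re ν ≤ k − 1`, `Im ν ≠ 0`, `0 < ρ ≤ 1` and `G` of class `C^∞` on `(−ρ, ρ)` there is `Y` of class `C^∞`
on `(−ρ, ρ)` with `x Y′ = ν Y + G` there and `‖Y(x)‖ ≤ (k/|Im ν| + 1)·M` whenever `‖G⁽ʲ⁾(y)‖ ≤ M` for `|y| ≤ |x|`,
`j ≤ k`: `Y = Σ_{n<k} G⁽ⁿ⁾(0)xⁿ/(n!(n−ν)) + ∫₀¹ s^{−ν−1} G̃(xs) ds`, `G̃ = G −` (Taylor polynomial of order `k−1`).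
[cite: CoddingtonLevinson1955, Ch. 4 §2] -/
theorem euler_smooth_solution : ∀ (ν : ℂ) (k : ℕ) (ρ : ℝ) (G : ℝ → ℂ), ν.re ≤ (k : ℝ) - 1 → ν.im ≠ 0 → 0 < ρ → ρ ≤ 1 → ContDiffOn ℝ ∞ G (Set.Ioo (-ρ) ρ) → ∃ Y : ℝ → ℂ, ContDiffOn ℝ ∞ Y (Set.Ioo (-ρ) ρ) ∧ (∀ x ∈ Set.Ioo (-ρ) ρ, (x : ℂ) * deriv Y x = ν * Y x + G x) ∧ ∀ x ∈ Set.Ioo (-ρ) ρ, ∀ M : ℝ, (∀ y ∈ Set.Icc (-|x|) |x|, ∀ j : ℕ, j ≤ k → ‖iteratedDeriv j G y‖ ≤ M) → ‖Y x‖ ≤ ((k : ℝ) / |ν.im| + 1) * M := by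
  intro ν k ρ G hν hνi hρ hρ1 hG
  set U : Set ℝ := Ioo (-ρ) ρ with hU_def
  have hU : IsOpen U := isOpen_Ioo
  have memU : ∀ {x : ℝ}, x ∈ U ↔ |x| < ρ := fun {x} => by rw [hU_def, mem_Ioo, abs_lt]
  have hxsU : ∀ {x : ℝ}, |x| < ρ → ∀ {s : ℝ}, s ∈ Icc (0 : ℝ) 1 → x * s ∈ U := by
    intro x hx s hs
    refine memU.2 (lt_of_le_of_lt ?_ hx)
    rw [abs_mul, abs_of_nonneg hs.1]
    exact mul_le_of_le_one_right (abs_nonneg x) hs.2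
  -- Taylor data and the flat remainder chain `D j = G⁽ʲ⁾ − (Taylor sum)`
  set c : ℕ → ℂ := fun n => iteratedDeriv n G 0 with hc
  set D : ℕ → ℝ → ℂ := fun j y =>
    iteratedDeriv j G y - ∑ n ∈ Finset.range (k - j), c (n + j) / (n ! : ℂ) * (y : ℂ) ^ n with hD_def
  have hD : ∀ j, ∀ y ∈ U, HasDerivAt (D j) (D (j + 1) y) y := fun j y hy =>
    (hasDerivAt_iteratedDeriv_of_contDiffOn hU hG j hy).sub (hasDerivAt_taylorSum_family c k j y)
  have hD0 : ∀ j < k, D j 0 = 0 := by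
    intro j hj
    show iteratedDeriv j G 0 - ∑ n ∈ Finset.range (k - j), c (n + j) / (n ! : ℂ) * ((0 : ℝ) : ℂ) ^ n = 0
    rw [taylorSum_family_zero c k j, if_pos hj]
    simp [hc]
  have hDk : ∀ j, k ≤ j → ∀ y, D j y = iteratedDeriv j G y := fun j hj y => by
    simp [hD_def, Nat.sub_eq_zero_of_le hj]
  have hDG : ∀ y, D 0 y = G y - ∑ n ∈ Finset.range k, c n / (n ! : ℂ) * (y : ℂ) ^ n := fun y => by simp [hD_def]
  have hDcont : ∀ j, ContinuousOn (D j) U := fun j y hy => (hD j y hy).continuousAt.continuousWithinAt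
  -- flat bounds for the chain on compact sub-intervals
  have DB : ∀ (j : ℕ) (r : ℝ), 0 ≤ r → r < ρ → ∃ B : ℝ, 0 ≤ B ∧ ∀ y ∈ Icc (-r) r, ‖D j y‖ ≤ B * |y| ^ (k - j) := by
    intro j r hr hrρ
    have hsub : Icc (-r) r ⊆ U := fun y hy => memU.2 (lt_of_le_of_lt (abs_le.2 hy) hrρ)
    rcases le_or_gt j k with hjk | hjk
    · obtain ⟨B, hB⟩ := (isCompact_Icc (a := -r) (b := r)).exists_bound_of_continuousOn ((hDcont k).mono hsub)
      refine ⟨max B 0, le_max_right _ _, ?_⟩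
      have := norm_le_of_flat_family_gen (k - j) (fun i => D (j + i)) r (max B 0)
        (fun i _ y hy => by simpa [add_assoc] using hD (j + i) y (hsub hy)) (fun i hi => hD0 (j + i) (by omega))
        (fun y hy => by simpa [Nat.add_sub_cancel' hjk] using (hB y hy).trans (le_max_left B 0))
      simpa using this
    · obtain ⟨B, hB⟩ := (isCompact_Icc (a := -r) (b := r)).exists_bound_of_continuousOn ((hDcont j).mono hsub)
      refine ⟨max B 0, le_max_right _ _, fun y hy => ?_⟩
      simpa [Nat.sub_eq_zero_of_le hjk.le] using (hB y hy).trans (le_max_left B 0)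
  -- exponent bookkeeping: `Re(j − ν − 1) + (k − j) ≥ 0`
  have hexp : ∀ j : ℕ, 0 ≤ ((j : ℂ) - ν - 1).re + ((k - j : ℕ) : ℝ) := by
    intro j
    simp only [Complex.sub_re, Complex.natCast_re, Complex.one_re]
    rcases le_or_gt j k with hjk | hjk
    · rw [Nat.cast_sub hjk]; linarith
    · have : (k : ℝ) + 1 ≤ j := by exact_mod_cast hjk
      simp [Nat.sub_eq_zero_of_le hjk.le]; linarith
  -- the integrals `I j x = ∫₀¹ s^{j−ν−1} D j (x s) ds`
  set I : ℕ → ℝ → ℂ := fun j x => ∫ s in (0 : ℝ)..1, (s : ℂ) ^ ((j : ℂ) - ν - 1) * D j (x * s) with hI_def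
  have hmeasI : ∀ (j : ℕ) (x : ℝ), |x| < ρ → ∀ (w : ℝ → ℂ), ContinuousOn w (Ioc 0 1) →
      AEStronglyMeasurable (fun s : ℝ => w s * D j (x * s)) (volume.restrict (Ι (0 : ℝ) 1)) := by
    intro j x hx w hw
    rw [uIoc_of_le zero_le_one]
    refine ContinuousOn.aestronglyMeasurable (hw.mul fun s hs => ?_) measurableSet_Ioc
    exact ((hD j _ (hxsU hx ⟨hs.1.le, hs.2⟩)).continuousAt.comp_continuousWithinAt
      ((continuous_const.mul continuous_id).continuousWithinAt)).mono (fun _ h => h)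
  have hcpow_cont : ∀ a : ℂ, ContinuousOn (fun s : ℝ => (s : ℂ) ^ a) (Ioc 0 1) := fun a s hs =>
    (Complex.continuousAt_ofReal_cpow_const s a (Or.inr hs.1.ne')).continuousWithinAt
  -- uniform bound of the integrands near a point, and integrability
  have hbound : ∀ (j : ℕ) (r : ℝ), 0 ≤ r → r < ρ → ∃ C : ℝ, ∀ x, |x| ≤ r → ∀ s ∈ Ioc (0 : ℝ) 1,
      ‖(s : ℂ) ^ ((j : ℂ) - ν - 1) * D j (x * s)‖ ≤ C := by
    intro j r hr hrρ
    obtain ⟨B, hB0, hB⟩ := DB j r hr hrρ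
    exact ⟨B * r ^ (k - j), fun x hx s hs => norm_cpow_mul_le hB0 hr hB (hexp j) hx hs⟩
  have hintI : ∀ (j : ℕ) (x : ℝ), |x| < ρ →
      IntervalIntegrable (fun s : ℝ => (s : ℂ) ^ ((j : ℂ) - ν - 1) * D j (x * s)) volume 0 1 := by
    intro j x hx
    obtain ⟨C, hC⟩ := hbound j |x| (abs_nonneg x) hx
    refine IntervalIntegrable.mono_fun' (intervalIntegrable_const (c := C)) (hmeasI j x hx _ (hcpow_cont _)) ?_
    rw [EventuallyLE, ae_restrict_iff' measurableSet_uIoc]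
    exact Eventually.of_forall fun s hs => hC x le_rfl s (by rwa [uIoc_of_le zero_le_one] at hs)
  -- DIFFERENTIATION UNDER THE INTEGRAL: `I j` has derivative `I (j+1)` on `U`
  have hIder : ∀ j, ∀ x ∈ U, HasDerivAt (I j) (I (j + 1) x) x := by
    intro j x₀ hx₀
    have hx₀' : |x₀| < ρ := memU.1 hx₀
    set r : ℝ := (|x₀| + ρ) / 2 with hr_def
    have hr0 : 0 ≤ r := by rw [hr_def]; linarith [abs_nonneg x₀]
    have hx₀r : |x₀| < r := by rw [hr_def]; linarith
    have hrρ : r < ρ := by rw [hr_def]; linarith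
    have hS : Ioo (-r) r ∈ 𝓝 x₀ := isOpen_Ioo.mem_nhds (by rw [mem_Ioo, ← abs_lt]; exact hx₀r)
    have hSr : ∀ x ∈ Ioo (-r) r, |x| < r := fun x hx => abs_lt.2 hx
    have hshift : ∀ (x s : ℝ), 0 < s → (s : ℂ) ^ ((j : ℂ) - ν - 1) * ((s : ℂ) * D (j + 1) (x * s)) =
        (s : ℂ) ^ (((j + 1 : ℕ) : ℂ) - ν - 1) * D (j + 1) (x * s) := fun x s hs => by
      rw [← mul_assoc, ofReal_cpow_mul_self hs]; congr 2; push_cast; ring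
    obtain ⟨C, hC⟩ := hbound (j + 1) r hr0 hrρ
    have key := intervalIntegral.hasDerivAt_integral_of_dominated_loc_of_deriv_le (μ := volume)
      (a := (0 : ℝ)) (b := 1) (bound := fun _ => C) (F := fun (x : ℝ) (s : ℝ) => (s : ℂ) ^ ((j : ℂ) - ν - 1) * D j (x * s))
      (F' := fun (x : ℝ) (s : ℝ) => (s : ℂ) ^ ((j : ℂ) - ν - 1) * ((s : ℂ) * D (j + 1) (x * s))) hS
      (Filter.eventually_of_mem hS fun x hx => hmeasI j x ((hSr x hx).trans hrρ) _ (hcpow_cont _))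
      (hintI j x₀ hx₀') ?_ ?_ intervalIntegrable_const ?_
    · have heq : (∫ s in (0 : ℝ)..1, (s : ℂ) ^ ((j : ℂ) - ν - 1) * ((s : ℂ) * D (j + 1) (x₀ * s))) = I (j + 1) x₀ :=
        integral_congr_ae (Eventually.of_forall fun s hs => hshift x₀ s (by rw [uIoc_of_le zero_le_one] at hs; exact hs.1))
      simpa only [heq] using key.2
    · refine (hmeasI (j + 1) x₀ hx₀' (fun s => (s : ℂ) ^ ((j : ℂ) - ν - 1) * (s : ℂ))
        ((hcpow_cont _).mul Complex.continuous_ofReal.continuousOn)).congr ?_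
      exact Eventually.of_forall fun s => by simp only; ring
    · refine Eventually.of_forall fun s hs x hx => ?_
      rw [uIoc_of_le zero_le_one] at hs
      rw [hshift x s hs.1]
      exact hC x (hSr x hx).le s hs
    · refine Eventually.of_forall fun s hs x hx => ?_
      rw [uIoc_of_le zero_le_one] at hs
      have h1 : HasDerivAt (fun x : ℝ => D j (x * s)) ((s : ℝ) • D (j + 1) (x * s)) x :=
        (hD j _ (hxsU ((hSr x hx).trans hrρ) ⟨hs.1.le, hs.2⟩)).scomp x (hasDerivAt_mul_const s)
      rw [Complex.real_smul] at h1
      exact h1.const_mul _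
  have hIsmooth : ContDiffOn ℝ ∞ (I 0) U := contDiffOn_of_deriv_family hU I hIder 0
  -- INTEGRATION BY PARTS: `x I₁(x) = ν I₀(x) + D₀(x)`
  have hIBP : ∀ x ∈ U, (x : ℂ) * I 1 x = ν * I 0 x + D 0 x := by
    intro x hx
    have hx' : |x| < ρ := memU.1 hx
    obtain ⟨B₀, hB₀0, hB₀⟩ := DB 0 |x| (abs_nonneg x) hx'
    set Φ : ℝ → ℂ := fun s => (s : ℂ) ^ (-ν) * D 0 (x * s) with hΦ
    set Φ' : ℝ → ℂ := fun s => (-ν) * ((s : ℂ) ^ (((0 : ℕ) : ℂ) - ν - 1) * D 0 (x * s)) +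
      (x : ℂ) * ((s : ℂ) ^ (((1 : ℕ) : ℂ) - ν - 1) * D 1 (x * s)) with hΦ'
    have hΦder : ∀ s ∈ Ioo (0 : ℝ) 1, HasDerivAt Φ (Φ' s) s := by
      intro s hs
      have h1 : HasDerivAt (fun s : ℝ => (s : ℂ) ^ (-ν)) (-ν * (s : ℂ) ^ (-ν - 1)) s :=
        (Complex.hasStrictDerivAt_cpow_const (c := -ν) (Complex.ofReal_mem_slitPlane.2 hs.1)).hasDerivAt.comp_ofReal
      have h2 : HasDerivAt (fun s : ℝ => D 0 (x * s)) ((x : ℝ) • D 1 (x * s)) s :=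
        (hD 0 _ (hxsU hx' ⟨hs.1.le, hs.2.le⟩)).scomp s (hasDerivAt_const_mul x |>.congr_deriv (by simp))
      rw [Complex.real_smul] at h2
      refine (h1.mul h2).congr_deriv ?_
      have e2 : (((1 : ℕ) : ℂ) - ν - 1) = -ν := by push_cast; ring
      have e3 : (((0 : ℕ) : ℂ) - ν - 1) = -ν - 1 := by push_cast; ring
      simp only [hΦ', e2, e3]
      ring
    have hΦ0 : Φ 0 = 0 := by
      simp only [hΦ, Complex.ofReal_zero]
      rw [Complex.zero_cpow (neg_ne_zero.2 (fun h => hνi (by rw [h]; simp))), zero_mul]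
    -- continuity of `Φ` on `[0, 1]` (at `0`: `‖Φ s‖ ≤ B₀ |x|^k s^{k − Re ν} → 0`)
    have hΦcont : ContinuousOn Φ (Icc 0 1) := by
      intro s hs
      rcases eq_or_lt_of_le hs.1 with h | h
      · subst h
        rw [ContinuousWithinAt, hΦ0]
        have hk : 0 < (k : ℝ) - ν.re := by linarith
        have hlim : Tendsto (fun s : ℝ => B₀ * |x| ^ k * s ^ ((k : ℝ) - ν.re)) (𝓝[Icc 0 1] 0) (𝓝 0) := by
          have h2 := ((Real.continuousAt_rpow_const 0 _ (Or.inr hk.le)).tendsto).const_mul (B₀ * |x| ^ k)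
          rw [Real.zero_rpow hk.ne', mul_zero] at h2
          exact h2.mono_left nhdsWithin_le_nhds
        refine squeeze_zero_norm' (eventually_nhdsWithin_of_forall fun s hs => ?_) hlim
        rcases eq_or_lt_of_le hs.1 with h' | h'
        · subst h'; rw [hΦ0, norm_zero]
          exact mul_nonneg (mul_nonneg hB₀0 (pow_nonneg (abs_nonneg x) k)) (Real.rpow_nonneg le_rfl _)
        · have := norm_cpow_mul_le (a := -ν) hB₀0 (abs_nonneg x) hB₀ ?_ le_rfl ⟨h', hs.2⟩
          · simp only [hΦ]
            rw [norm_mul, Complex.norm_cpow_eq_rpow_re_of_pos h', Complex.neg_re]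
            have habs : |x * s| ≤ |x| := by
              rw [abs_mul, abs_of_pos h']; exact mul_le_of_le_one_right (abs_nonneg x) hs.2
            have hxs : x * s ∈ Icc (-|x|) |x| := ⟨by linarith [(abs_le.1 habs).1], (abs_le.1 habs).2⟩
            calc s ^ (-ν.re) * ‖D 0 (x * s)‖ ≤ s ^ (-ν.re) * (B₀ * |x * s| ^ (k - 0)) :=
                  mul_le_mul_of_nonneg_left (hB₀ _ hxs) (Real.rpow_nonneg h'.le _)
              _ = B₀ * |x| ^ k * (s ^ (-ν.re) * s ^ (k : ℝ)) := by
                  rw [Nat.sub_zero, abs_mul, abs_of_pos h', mul_pow, Real.rpow_natCast]; ring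
              _ = B₀ * |x| ^ k * s ^ ((k : ℝ) - ν.re) := by rw [← Real.rpow_add h']; ring_nf
          · simp only [Complex.neg_re, Nat.sub_zero]; linarith
      · exact ((Complex.continuousAt_ofReal_cpow_const s _ (Or.inr h.ne')).mul ((hD 0 _ (hxsU hx' ⟨hs.1, hs.2⟩)
          ).continuousAt.comp (continuous_const.mul continuous_id).continuousAt)).continuousWithinAt
    -- the fundamental theorem of calculus for `Φ` on `[0, 1]`
    have hint0 := hintI 0 x hx'
    have hint1 := hintI 1 x hx'
    have hFTC := intervalIntegral.integral_eq_sub_of_hasDerivAt_of_le zero_le_one hΦcont hΦder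
      ((hint0.const_mul (-ν)).add (hint1.const_mul (x : ℂ)))
    have hΦ1 : Φ 1 = D 0 x := by simp [hΦ]
    have hsplit : (∫ s in (0 : ℝ)..1, Φ' s) = (-ν) * I 0 x + (x : ℂ) * I 1 x := by
      simp only [hΦ', hI_def]
      rw [intervalIntegral.integral_add (hint0.const_mul _) (hint1.const_mul _),
        intervalIntegral.integral_const_mul, intervalIntegral.integral_const_mul]
    rw [hΦ1, hΦ0, sub_zero, hsplit] at hFTC
    linear_combination hFTC
  -- THE TAYLOR PART `P(x) = Σ_{n<k} cₙ xⁿ/(n!(n − ν))`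
  have hν0 : ν ≠ 0 := fun h => hνi (by simp [h])
  have hnν : ∀ n : ℕ, ((n : ℂ) - ν) ≠ 0 := fun n h => hνi (by simpa using congrArg Complex.im h)
  set P : ℝ → ℂ := fun x => ∑ n ∈ Finset.range k, c n / ((n ! : ℂ) * ((n : ℂ) - ν)) * (x : ℂ) ^ n with hP_def
  set P' : ℝ → ℂ := fun x =>
    ∑ n ∈ Finset.range k, c n / ((n ! : ℂ) * ((n : ℂ) - ν)) * ((n : ℂ) * (x : ℂ) ^ (n - 1)) with hP'_def
  have hPder : ∀ x, HasDerivAt P (P' x) x := fun x =>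
    HasDerivAt.fun_sum fun n _ => ((hasDerivAt_pow n (x : ℂ)).comp_ofReal).const_mul _
  have hPode : ∀ x : ℝ, (x : ℂ) * P' x = ν * P x + ∑ n ∈ Finset.range k, c n / (n ! : ℂ) * (x : ℂ) ^ n := by
    intro x
    simp only [hP_def, hP'_def, Finset.mul_sum, ← Finset.sum_add_distrib]
    refine Finset.sum_congr rfl fun n _ => ?_
    have hf : (n ! : ℂ) ≠ 0 := by exact_mod_cast Nat.factorial_ne_zero n
    have hn := hnν n
    rcases Nat.eq_zero_or_pos n with rfl | hpos
    · simp only [Nat.factorial_zero, Nat.cast_one, one_mul, Nat.cast_zero, zero_mul, mul_zero, pow_zero, mul_one]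
      field_simp
      ring
    · obtain ⟨m, rfl⟩ := Nat.exists_eq_succ_of_ne_zero hpos.ne'
      simp only [Nat.succ_eq_add_one, Nat.add_sub_cancel, pow_succ]
      field_simp
      ring
  have hPsmooth : ContDiff ℝ ∞ P := ContDiff.sum fun n _ => contDiff_const.mul (Complex.ofRealCLM.contDiff.pow n)
  -- THE SOLUTION `Y = P + I₀`
  refine ⟨fun x => P x + I 0 x, hPsmooth.contDiffOn.add hIsmooth, fun x hx => ?_, fun x hx M hM => ?_⟩
  · rw [((hPder x).fun_add (hIder 0 x hx)).deriv, mul_add, hPode x, hIBP x hx, hDG x]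
    ring
  · have hx' : |x| < ρ := memU.1 hx
    have hx1 : |x| ≤ 1 := hx'.le.trans hρ1
    have h0x : (0 : ℝ) ∈ Icc (-|x|) |x| := ⟨neg_nonpos.2 (abs_nonneg x), abs_nonneg x⟩
    have hM0 : 0 ≤ M := (norm_nonneg _).trans (hM 0 h0x 0 (Nat.zero_le k))
    have hνim : 0 < |ν.im| := abs_pos.2 hνi
    -- the Taylor part
    have hPb : ‖P x‖ ≤ (k : ℝ) / |ν.im| * M := by
      have hterm : ∀ n ∈ Finset.range k, ‖c n / ((n ! : ℂ) * ((n : ℂ) - ν)) * (x : ℂ) ^ n‖ ≤ M / |ν.im| := by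
        intro n hn
        have hcn : ‖c n‖ ≤ M := hM 0 h0x n (Finset.mem_range.1 hn).le
        have h1 : (1 : ℝ) ≤ ‖(n ! : ℂ)‖ := by
          rw [Complex.norm_natCast]; exact_mod_cast Nat.one_le_iff_ne_zero.2 (Nat.factorial_ne_zero n)
        have h2 : |ν.im| ≤ ‖(n : ℂ) - ν‖ := by simpa using Complex.abs_im_le_norm ((n : ℂ) - ν)
        rw [norm_mul, norm_div, norm_mul, norm_pow, Complex.norm_real, Real.norm_eq_abs]
        calc ‖c n‖ / (‖(n ! : ℂ)‖ * ‖(n : ℂ) - ν‖) * |x| ^ n ≤ M / (1 * |ν.im|) * 1 :=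
              mul_le_mul (div_le_div₀ hM0 hcn (by positivity) (mul_le_mul h1 h2 hνim.le (by positivity)))
                (pow_le_one₀ (abs_nonneg x) hx1) (by positivity) (by positivity)
          _ = M / |ν.im| := by ring
      calc ‖P x‖ ≤ ∑ n ∈ Finset.range k, ‖c n / ((n ! : ℂ) * ((n : ℂ) - ν)) * (x : ℂ) ^ n‖ := norm_sum_le _ _
        _ ≤ ∑ n ∈ Finset.range k, M / |ν.im| := Finset.sum_le_sum hterm
        _ = (k : ℝ) / |ν.im| * M := by rw [Finset.sum_const, Finset.card_range, nsmul_eq_mul]; ring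
    -- the flat part
    have hIb : ‖I 0 x‖ ≤ M := by
      have hsub : Icc (-|x|) |x| ⊆ U := fun y hy => memU.2 (lt_of_le_of_lt (abs_le.2 hy) hx')
      have hflat : ∀ y ∈ Icc (-|x|) |x|, ‖D 0 y‖ ≤ M * |y| ^ (k - 0) := by
        simpa using norm_le_of_flat_family_gen k D |x| M (fun j _ y hy => hD j y (hsub hy)) hD0
          (fun y hy => by rw [hDk k le_rfl]; exact hM y hy k le_rfl)
      have hb : ∀ s ∈ Ι (0 : ℝ) 1, ‖(s : ℂ) ^ (((0 : ℕ) : ℂ) - ν - 1) * D 0 (x * s)‖ ≤ M * |x| ^ (k - 0) :=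
        fun s hs => norm_cpow_mul_le hM0 (abs_nonneg x) hflat (hexp 0) le_rfl (by rwa [uIoc_of_le zero_le_one] at hs)
      calc ‖I 0 x‖ ≤ M * |x| ^ (k - 0) * |1 - 0| := norm_integral_le_of_norm_le_const hb
        _ = M * |x| ^ k := by simp
        _ ≤ M * 1 := by gcongr; exact pow_le_one₀ (abs_nonneg x) hx1
        _ = M := mul_one M
    calc ‖P x + I 0 x‖ ≤ ‖P x‖ + ‖I 0 x‖ := norm_add_le _ _
      _ ≤ (k : ℝ) / |ν.im| * M + M := add_le_add hPb hIb
      _ = ((k : ℝ) / |ν.im| + 1) * M := by ring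

end Summit.AtomisticToContinuum.HydrodynamicLimit.Theorems.SonicCavityRenewal

end
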